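import Literature.InformationTheory.QuantumCodes.QuantumExpanderNoisySyndromeEquivalence
import HarnessLib

/-!
# Small-set-flip with a NOISY syndrome (Fawzi–Grospellier–Leverrier, FOCS 2018), part 5: §3.4 Lemma 26, second half —
# witnesses for every subset of the minimum-weight residual `E_ls` — PROOF (deterministic)

Index of sources: `[cite: FawziGrospellierLeverrier2018FT]` = Fawzi–Grospellier–Leverrier, FOCS 2018 / arXiv:1808.03821, §3.4 Lemma 26
(p0020 L41-44: "If `|MaxConn_{α₀}(E ∪ D)| ≤ γ₀√n` then there is a reduced error `E_ls` equivalent to the remaining error `E ⊕ Ê` such that for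
all `S ⊆ E_ls` there is a `c₀`-witness for `(S, D)`") and the second half of its proof (p0021 L6-9: "for each `K`, there is a witness `W_K`
for `S_K := S ∩ K` with `W_K ⊆ E_ls ∩ K` … the behavior of the algorithm is the same on input `(E, D)` and on input `(E', D)` … By
locality … the remaining error of the last execution is `(E' ⊕ Ê) ∩ K = E_ls ∩ K` which is reduced and is of weight smaller than
`γ₀√n`. By Lemma 25, there is a `c₀`-witness `W_K` … Finally, `W = ⊎_K W_K` is a `c₀`-witness for `S`."), Def. 24, Lemmas 19–21, 25.

Topic `Literature/InformationTheory/QuantumCodes` (venture QEC, row 04 `prover-qec-type-04` gen 8, line L-SSF-NOISY = PARTITION v2.48 D50.L8,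
node N13). Setting and dictionary as in parts 1–4 (tree decoder rule `κ|F|`, `β = 2κ/min Δ`, `c₀ = 4/(min Δ·β₁ − 2κ)`, `β₁ = 1 − 16δ`,
`δ = max(δ_A, δ_B)`); the percolation HYPOTHESIS is the one of part 4 (`fgl18b_lemma26_equiv`) with the threshold the printed proof needs here,
`max Δ·|K| ≤ min Δ·min(γ_A n_A, γ_B n_B)` (printed `|K| ≤ γ₀√n`). As in part 3, a witness is given by its defining inequality: for EVERY
`W ⊆ supp E_ls` closed in `supp E_ls` for the check-adjacency (the printed `W` = the components of `E_ls` meeting `S`, which lies in `𝓜(S)`),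
`|W| ≤ c₀·|D ∩ Γ_X(W)|`.

* `haltingTest_indicator` — the printed halting test survives restriction of the syndrome to any set of checks (Lemma 21 (i));
* ★ `fgl18b_lemma26_witness` — **Lemma 26, second half** for quantum expander codes and every small-set-flip decoder of the tree:
  component by component (`K` ranging over the connected components of `U ∪ supp E_ls` in `𝒢 = checkGraph (H_X; H_Z)`), the restricted
  problem `(E_ls ∩ K, D ∩ Γ_X(K))` is at a halting syndrome (locality), `E_ls ∩ K` is reduced (global minimality + Lemma 17) and small
  (the `α₀`-subset inequality of part 4 + the hypothesis), so Lemma 25 bounds `|W ∩ K|` by `c₀|D ∩ Γ_X(W ∩ K)|`; the check-neighbourhoods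
  of distinct components are disjoint, and summing gives `|W| ≤ c₀|D ∩ Γ_X(W)|`.

Column word: PROVED (kernel); no definitions, no named facts. With parts 1–5 every DETERMINISTIC statement of FGL18b §3.3–§3.4 is in the
tree; Thm. 13 additionally needs Lemma 27 (`α`-percolation on the mixed graph `V ⊔ C_X`) and the witness-counting union bound (not here).
-/

namespace Literature.InformationTheory.QuantumCodes

open Finset Matrix Literature.Probability.LatticeModels

namespace QuantumExpander

variable {A B : Type*} [Fintype A] [Fintype B] [DecidableEq A] [DecidableEq B]

/-- **The halting test survives restriction** (FGL18b Lemma 21 (i) applied to the while-condition): if no `F ∈ 𝓕` passes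
`Δ(σ, F) ≥ β|σ_X(F)|`, then none passes it for the restricted syndrome `σ ∩ C_K` either, since `Δ(σ ∩ C_K, F) ≤ Δ(σ, F)`.
[cite: FawziGrospellierLeverrier2018FT, Lemma 25 proof ("By locality … no flip is done … on the input E_R ∩ W, D ∩ Γ_X(W)"; arXiv p0020 L30-31)] -/
theorem haltingTest_indicator (H : Matrix B A (ZMod 2)) {dm β : ℝ} {σ : A × B → ZMod 2} (CK : Finset (A × B))
    (hhalt : ∀ F ∈ smallSets (expanderHZ H),
      dm / 2 * F.card ≤ hammingNorm (expanderHX H *ᵥ flipVec F) →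
      ¬ (β * hammingNorm (expanderHX H *ᵥ flipVec F) ≤ syndromeDecrease (expanderHX H) σ F)) :
    ∀ F ∈ smallSets (expanderHZ H),
      dm / 2 * F.card ≤ hammingNorm (expanderHX H *ᵥ flipVec F) →
      ¬ (β * hammingNorm (expanderHX H *ᵥ flipVec F)
          ≤ syndromeDecrease (expanderHX H) (Set.indicator (CK : Set (A × B)) σ) F) := by
  classical
  intro F hF hcal hdec
  have hle := SmallSetFlip.syndromeDecrease_indicator_le (expanderHX H) σ CK F
  have hleR : (syndromeDecrease (expanderHX H) (Set.indicator (CK : Set (A × B)) σ) F : ℝ)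
      ≤ syndromeDecrease (expanderHX H) σ F := by exact_mod_cast hle
  exact hhalt F hF hcal (hdec.trans hleR)

/-- A `0/1`-vector is the indicator of its support. [folklore] -/
private theorem flipVec_supp₅ (x : (A × A) ⊕ (B × B) → ZMod 2) : flipVec (supp x) = x := by
  classical
  funext q
  have h01 : ∀ z : ZMod 2, z = 0 ∨ z = 1 := by decide
  rcases h01 (x q) with h | h <;> simp [flipVec, supp, h]

/-- Restriction of a `0/1`-vector to `K` is the indicator of `supp ∩ K`. [folklore] -/
private theorem indicator_eq_flipVec_supp_inter (x : (A × A) ⊕ (B × B) → ZMod 2) (K : Finset ((A × A) ⊕ (B × B))) :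
    Set.indicator (K : Set ((A × A) ⊕ (B × B))) x = flipVec (supp x ∩ K) := by
  classical
  funext q
  have h01 : ∀ z : ZMod 2, z = 0 ∨ z = 1 := by decide
  by_cases hq : q ∈ K
  · rw [Set.indicator_of_mem (by exact_mod_cast hq)]
    rcases h01 (x q) with h | h <;> simp [flipVec, supp, h, hq]
  · rw [Set.indicator_of_notMem (by exact_mod_cast hq)]
    simp [flipVec, hq]

/-- ★ **FGL18b Lemma 26, second half (witnesses for `E_ls`), for quantum expander codes and the tree's small-set-flip decoders.**
Let `G` be `(Δ_A, Δ_B)`-biregular (`Δ ≥ 1`), `(γ_A, δ_A, γ_B, δ_B)`-expanding, `δ = max(δ_A, δ_B) ≥ 0`, `Dec` a small-set-flip decoder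
of the tree with threshold `κ` (`0 < κ`, `2κ < min Δ·β₁`) run on the noisy syndrome `σ_X(E) ⊕ 𝟙_D` with output `Ê`, and `E_ls` a
minimum-weight word with `σ_X(E_ls) = σ_X(E ⊕ Ê)`. Percolation hypothesis (what "`MaxConn_{α₀}(E ∪ D) ≤ γ₀√n`" gives): every `K`
connected in `𝒢 = checkGraph (H_X; H_Z)` with `κ(|K| + |D ∩ Γ_X(K)|) ≤ 2(κ + max Δ)(|E ∩ K| + |D ∩ Γ_X(K)|)` has
`max Δ·|K| ≤ min Δ·min(γ_A n_A, γ_B n_B)`. Then EVERY `W ⊆ supp E_ls` closed in `supp E_ls` for the check-adjacency — in particular the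
`c₀`-witness of the printed proof, the components of `E_ls` meeting a given `S ⊆ E_ls` — satisfies `|W| ≤ c₀·|D ∩ Γ_X(W)|`,
`c₀ = 4/(min Δ·β₁ − 2κ)`. [cite: FawziGrospellierLeverrier2018FT, Lemma 26, second half of the proof (arXiv p0021 L6-9); Lemma 25; Def 24] -/
theorem fgl18b_lemma26_witness (H : Matrix B A (ZMod 2)) {dA dB : ℕ} {γA δA γB δB : ℝ}
    (hreg : IsBiregular H dA dB) (hexp : IsLeftRightExpanding H dA dB γA δA γB δB)
    (hdA : 0 < dA) (hdB : 0 < dB) (hδA : 0 ≤ δA) (hδB : 0 ≤ δB)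
    {κ : ℝ} (hκ0 : 0 < κ) (hκ1 : 2 * κ < ((min dA dB : ℕ) : ℝ) * (1 - 16 * max δA δB))
    (Dec : Decoder (A × B → ZMod 2) ((A × A) ⊕ (B × B) → ZMod 2))
    (hDec : IsSSFDecoder κ (expanderHX H) (expanderHZ H) Dec)
    (E : Finset ((A × A) ⊕ (B × B))) (D : Finset (A × B))
    (eLs : (A × A) ⊕ (B × B) → ZMod 2)
    (hsyn : expanderHX H *ᵥ eLs = expanderHX H *ᵥ (flipVec E + Dec (expanderHX H *ᵥ flipVec E + flipVec D)))
    (hmin : ∀ v : (A × A) ⊕ (B × B) → ZMod 2, expanderHX H *ᵥ v = expanderHX H *ᵥ eLs →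
      hammingNorm eLs ≤ hammingNorm v)
    (hclus : ∀ K : Finset ((A × A) ⊕ (B × B)),
      IsGraphConnected (checkGraph (Matrix.fromRows (expanderHX H) (expanderHZ H))) K →
      κ * ((K.card : ℝ) + (D ∩ univ.filter fun c => ∃ q ∈ K, expanderHX H c q ≠ 0).card)
        ≤ 2 * (κ + ((max dA dB : ℕ) : ℝ))
          * (((E ∩ K).card : ℝ) + (D ∩ univ.filter fun c => ∃ q ∈ K, expanderHX H c q ≠ 0).card) →
      ((max dA dB : ℕ) : ℝ) * K.card ≤ ((min dA dB : ℕ) : ℝ) * min (γA * Fintype.card A) (γB * Fintype.card B))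
    (W : Finset ((A × A) ⊕ (B × B))) (hWsub : W ⊆ supp eLs)
    (hWX : ∀ q ∈ W, ∀ q' ∈ supp eLs, ∀ c, expanderHX H c q ≠ 0 → expanderHX H c q' ≠ 0 → q' ∈ W) :
    (W.card : ℝ) ≤ 4 / (((min dA dB : ℕ) : ℝ) * (1 - 16 * max δA δB) - 2 * κ)
        * ((D ∩ univ.filter fun c => ∃ q ∈ W, expanderHX H c q ≠ 0).card : ℝ) := by
  classical
  -- constants and the run
  have hdm' : (0 : ℝ) < ((min dA dB : ℕ) : ℝ) := by exact_mod_cast lt_min hdA hdB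
  have hdM0 : (0 : ℝ) ≤ ((max dA dB : ℕ) : ℝ) := Nat.cast_nonneg _
  have hdM1 : (1 : ℝ) ≤ ((max dA dB : ℕ) : ℝ) := by exact_mod_cast le_trans hdA (le_max_left _ _)
  set β : ℝ := 2 * κ / ((min dA dB : ℕ) : ℝ) with hβdef
  have hβ0 : 0 ≤ β := by positivity
  have hβ1 : β < 1 - 16 * max δA δB := by rw [hβdef, div_lt_iff₀ hdm']; linarith
  set c : ℝ := 4 / (((min dA dB : ℕ) : ℝ) * (1 - 16 * max δA δB) - 2 * κ) with hcdef
  have hc0 : 0 ≤ c := by rw [hcdef]; apply div_nonneg (by norm_num); linarith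
  have hcβ : 4 / (((min dA dB : ℕ) : ℝ) * (1 - 16 * max δA δB - β)) = c := by
    rw [hcdef, hβdef]; congr 1; field_simp
  obtain ⟨l, hrun, hl⟩ := hDec (expanderHX H *ᵥ flipVec E + flipVec D)
  rw [hl] at hsyn
  set Hs := expanderHX H with hHs
  set Hg := expanderHZ H with hHg
  set G := checkGraph (Matrix.fromRows Hs Hg) with hGdef
  have hGX : ∀ c q q', q ≠ q' → Hs c q ≠ 0 → Hs c q' ≠ 0 → G.Adj q q' :=
    fun c q q' hne h1 h2 => checkGraph_fromRows_adj_of_X H c q q' hne h1 h2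
  have hGZ : ∀ g q q', q ≠ q' → Hg g q ≠ 0 → Hg g q' ≠ 0 → G.Adj q q' :=
    fun g q q' hne h1 h2 => checkGraph_fromRows_adj_of_Z H g q q' hne h1 h2
  have hw : ∀ v : (A × A) ⊕ (B × B) → ZMod 2,
      (hammingNorm (Hs *ᵥ v) : ℝ) ≤ ((max dA dB : ℕ) : ℝ) * hammingNorm v := fun v => by
    exact_mod_cast hammingNorm_expanderHX_mulVec_le_max H hreg v
  -- the support of the run, and `U' = U ∪ supp E_ls`
  set U : Finset ((A × A) ⊕ (B × B)) := E ∪ l.toFinset.biUnion id with hUdef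
  have hEU : E ⊆ U := Finset.subset_union_left
  have hlU : ∀ F ∈ l, F ⊆ U := fun F hF q hq =>
    Finset.mem_union_right _ (Finset.mem_biUnion.2 ⟨F, List.mem_toFinset.2 hF, hq⟩)
  have hU : ∀ q ∈ U, q ∈ E ∨ ∃ F ∈ l, q ∈ F := by
    intro q hq
    rcases Finset.mem_union.1 hq with h | h
    · exact Or.inl h
    · obtain ⟨F, hF, hqF⟩ := Finset.mem_biUnion.1 h
      exact Or.inr ⟨F, List.mem_toFinset.1 hF, hqF⟩
  set x : (A × A) ⊕ (B × B) → ZMod 2 := flipVec E + runOutput l with hxdef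
  have hxU : ∀ q, x q ≠ 0 → q ∈ U := by
    intro q hq
    by_contra hqU
    apply hq
    have h1 : flipVec E q = 0 := by
      simp only [flipVec, ite_eq_right_iff, one_ne_zero, imp_false]
      exact fun hqE => hqU (hEU hqE)
    have h2 : runOutput l q = 0 := by
      by_contra h
      obtain ⟨F, hF, hqF⟩ := SmallSetFlip.exists_mem_of_runOutput_ne_zero l h
      exact hqU (hlU F hF hqF)
    rw [hxdef, Pi.add_apply, h1, h2, add_zero]
  set U' : Finset ((A × A) ⊕ (B × B)) := U ∪ supp eLs with hU'def
  have hUU' : U ⊆ U' := Finset.subset_union_left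
  have hLsU' : supp eLs ⊆ U' := Finset.subset_union_right
  -- `v = E_ls ⊕ x` has zero syndrome
  set v : (A × A) ⊕ (B × B) → ZMod 2 := eLs + x with hvdef
  have hv0 : Hs *ᵥ v = 0 := by
    rw [hvdef, Matrix.mulVec_add, hsyn]
    funext c'; simp only [Pi.add_apply, Pi.zero_apply]
    have h2 : ∀ a : ZMod 2, a + a = 0 := by decide
    exact h2 _
  have hvU' : ∀ q, v q ≠ 0 → q ∈ U' := by
    intro q hq
    rw [hU'def, Finset.mem_union]
    by_cases h1 : eLs q = 0
    · left; apply hxU; intro hx; apply hq; rw [hvdef, Pi.add_apply, h1, hx, add_zero]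
    · right; simpa [supp] using h1
  have hsuppv : supp v ⊆ U' := fun q hq => hvU' q (by simpa [supp] using hq)
  -- global facts: halting test at `σ_X(E_ls) ⊕ 𝟙_D`, `E_ls` reduced
  have hhalts := (ssfRun_invariants hrun).1
  have hfin : Hs *ᵥ flipVec E + flipVec D + Hs *ᵥ runOutput l = Hs *ᵥ eLs + flipVec D := by
    rw [hsyn, hxdef, Matrix.mulVec_add]; abel
  rw [hfin] at hhalts
  have hhalt := haltingTest_of_ssfHalts H hdA hdB hκ0 hhalts
  have hred : ∀ u ∈ rowSpace Hg, hammingNorm eLs ≤ hammingNorm (eLs + u) := by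
    intro u hu
    refine hmin (eLs + u) ?_
    rw [Matrix.mulVec_add, hHs, expanderHX_mulVec_eq_zero_of_mem_rowSpace H hu, add_zero]
  -- connected components of `U'` in `G`
  set r : ((A × A) ⊕ (B × B)) → ((A × A) ⊕ (B × B)) → Prop := fun a b => G.Adj a b ∧ a ∈ U' ∧ b ∈ U' with hrdef
  set comp : ((A × A) ⊕ (B × B)) → Finset ((A × A) ⊕ (B × B)) :=
    fun q => U'.filter fun q' => Relation.ReflTransGen r q q' with hcompdef
  have mem_comp : ∀ {q q'}, q' ∈ comp q ↔ q' ∈ U' ∧ Relation.ReflTransGen r q q' := by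
    intro q q'; simp only [hcompdef, Finset.mem_filter]
  have comp_subset : ∀ q, comp q ⊆ U' := fun q q' hq' => (mem_comp.1 hq').1
  have self_mem : ∀ {q}, q ∈ U' → q ∈ comp q := fun hq => mem_comp.2 ⟨hq, Relation.ReflTransGen.refl⟩
  have closed : ∀ {q a b}, a ∈ comp q → b ∈ U' → G.Adj a b → b ∈ comp q := by
    intro q a b ha hb hab
    rw [mem_comp] at ha ⊢
    exact ⟨hb, ha.2.tail ⟨hab, ha.1, hb⟩⟩
  have rsymm : ∀ {a b}, Relation.ReflTransGen r a b → Relation.ReflTransGen r b a := by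
    intro a b hab
    haveI : Std.Symm r := ⟨fun x y hxy => ⟨hxy.1.symm, hxy.2.2, hxy.2.1⟩⟩
    exact Std.Symm.symm _ _ hab
  have comp_eq : ∀ {q q'}, q' ∈ comp q → comp q' = comp q := by
    intro q q' h
    rw [mem_comp] at h
    ext z
    rw [mem_comp, mem_comp]
    constructor
    · rintro ⟨hz, hqz⟩; exact ⟨hz, h.2.trans hqz⟩
    · rintro ⟨hz, hqz⟩; exact ⟨hz, (rsymm h.2).trans hqz⟩
  have conn : ∀ {q}, q ∈ U' → IsGraphConnected G (comp q) := by
    intro q hq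
    rw [isGraphConnected_iff_reflTransGen (hv := self_mem hq)]
    intro z hz
    rw [mem_comp] at hz
    have key : ∀ z, Relation.ReflTransGen r q z →
        Relation.ReflTransGen (fun a b => G.Adj a b ∧ a ∈ comp q ∧ b ∈ comp q) q z := by
      intro z hz
      induction hz with
      | refl => exact Relation.ReflTransGen.refl
      | @tail s t hs hst ih =>
        have hs' : s ∈ comp q := mem_comp.2 ⟨hst.2.1, hs⟩
        exact ih.tail ⟨hst.1, hs', closed hs' hst.2.2 hst.1⟩
    exact key z hz.2
  have closedX : ∀ q₀, ∀ q ∈ comp q₀, ∀ q' ∈ U', ∀ c, Hs c q ≠ 0 → Hs c q' ≠ 0 → q' ∈ comp q₀ := by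
    intro q₀ q hq q' hq' c h1 h2
    by_cases hqq : q = q'
    · exact hqq ▸ hq
    · exact closed hq hq' (hGX c q q' hqq h1 h2)
  have closedZ : ∀ q₀, ∀ q ∈ comp q₀, ∀ q' ∈ U', ∀ g, Hg g q ≠ 0 → Hg g q' ≠ 0 → q' ∈ comp q₀ := by
    intro q₀ q hq q' hq' g h1 h2
    by_cases hqq : q = q'
    · exact hqq ▸ hq
    · exact closed hq hq' (hGZ g q q' hqq h1 h2)
  -- PER COMPONENT: `|W ∩ K| ≤ c |D ∩ Γ_X(W ∩ K)|`
  have hcomp : ∀ q₀ ∈ U', ((W ∩ comp q₀).card : ℝ)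
      ≤ c * ((D ∩ univ.filter fun c' => ∃ q ∈ W ∩ comp q₀, Hs c' q ≠ 0).card : ℝ) := by
    intro q₀ hq₀
    set K := comp q₀ with hKdef
    have hKU' : K ⊆ U' := comp_subset q₀
    set CK : Finset (A × B) := univ.filter fun c' => ∃ q ∈ K, Hs c' q ≠ 0 with hCK
    -- the restricted remaining error `E_ls ∩ K` and its observed syndrome
    set eK : (A × A) ⊕ (B × B) → ZMod 2 := flipVec (supp eLs ∩ K) with heK
    have hsuppeK : supp eK = supp eLs ∩ K := by rw [heK, supp_flipVec]
    have hres : Set.indicator (CK : Set (A × B)) (Hs *ᵥ eLs + flipVec D) = Hs *ᵥ eK + flipVec (D ∩ CK) := by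
      rw [Set.indicator_add', SmallSetFlip.indicator_flipVec]
      congr 1
      have h := SmallSetFlip.indicator_mulVec_flipVec_eq Hs U' K (supp eLs) (closedX q₀) hLsU'
      rw [flipVec_supp₅] at h
      rw [heK]; exact h
    -- (a) the halting test at the restricted syndrome, in the shape Lemma 25 wants (`eK + 0`)
    have hhaltK : ∀ F ∈ smallSets Hg,
        ((min dA dB : ℕ) : ℝ) / 2 * F.card ≤ hammingNorm (Hs *ᵥ flipVec F) →
        ¬ (β * hammingNorm (Hs *ᵥ flipVec F) ≤ syndromeDecrease Hs (Hs *ᵥ eK + flipVec (D ∩ CK)) F) := by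
      rw [← hres]
      exact haltingTest_indicator H CK hhalt
    -- (b) `E_ls ∩ K` is reduced (Lemma 17 from the reducedness of `E_ls`)
    have hredK : ∀ u ∈ rowSpace Hg, hammingNorm eK ≤ hammingNorm (eK + u) := fun u hu =>
      hammingNorm_le_hammingNorm_add_of_subset (by rw [hsuppeK]; exact Finset.inter_subset_left) (hred u hu)
    -- (c) `E_ls ∩ K` is small: the `α₀`-subset inequality for `K`, then the hypothesis
    have hKsmall : ((max dA dB : ℕ) : ℝ) * K.card
        ≤ ((min dA dB : ℕ) : ℝ) * min (γA * Fintype.card A) (γB * Fintype.card B) := by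
      refine hclus K (conn hq₀) ?_
      -- `K ∩ U` closed in `U`; Prop. 22 component form
      have hKUX : ∀ q ∈ K ∩ U, ∀ q' ∈ U, ∀ c', Hs c' q ≠ 0 → Hs c' q' ≠ 0 → q' ∈ K ∩ U := by
        intro q hq q' hq' c' h1 h2
        exact Finset.mem_inter.2 ⟨closedX q₀ q (Finset.mem_inter.1 hq).1 q' (hUU' hq') c' h1 h2, hq'⟩
      have hKUZ : ∀ q ∈ K ∩ U, ∀ q' ∈ U, ∀ g, Hg g q ≠ 0 → Hg g q' ≠ 0 → q' ∈ K ∩ U := by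
        intro q hq q' hq' g h1 h2
        exact Finset.mem_inter.2 ⟨closedZ q₀ q (Finset.mem_inter.1 hq).1 q' (hUU' hq') g h1 h2, hq'⟩
      have h22 := SmallSetFlip.card_closed_le_of_noisy_run hκ0 hw hrun hEU Finset.inter_subset_right hKUX hKUZ
        hlU hU
      have hEK : E ∩ (K ∩ U) = E ∩ K := by
        ext q; simp only [Finset.mem_inter]
        constructor
        · rintro ⟨h1, h2, -⟩; exact ⟨h1, h2⟩
        · rintro ⟨h1, h2⟩; exact ⟨h1, h2, hEU h1⟩
      rw [hEK] at h22
      have hCKU : ((D ∩ univ.filter fun c' => ∃ q ∈ K ∩ U, Hs c' q ≠ 0).card : ℝ) ≤ (D ∩ CK).card := by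
        have : (D ∩ univ.filter fun c' => ∃ q ∈ K ∩ U, Hs c' q ≠ 0) ⊆ D ∩ CK := by
          refine Finset.inter_subset_inter_left ?_
          intro c' hc
          rw [Finset.mem_filter] at hc ⊢
          obtain ⟨q, hq, hcq⟩ := hc.2
          exact ⟨hc.1, q, (Finset.mem_inter.1 hq).1, hcq⟩
        exact_mod_cast Finset.card_le_card this
      -- minimality: `|E_ls ∩ K| ≤ |x ∩ K| ≤ |K ∩ U|`
      have hpart0 : Hs *ᵥ Set.indicator (K : Set ((A × A) ⊕ (B × B))) (eLs + x) = 0 := by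
        have hloc := SmallSetFlip.indicator_mulVec_flipVec_eq Hs U' K (supp v) (closedX q₀) hsuppv
        rw [flipVec_supp₅, hv0, Set.indicator_zero', ← indicator_eq_flipVec_supp_inter] at hloc
        rw [← hvdef]; exact hloc.symm
      have hminK := SmallSetFlip.card_supp_inter_le_of_minWeight (Hs := Hs) eLs x K hmin hpart0
      have hxK : ((univ.filter fun q => x q ≠ 0) ∩ K).card ≤ (K ∩ U).card := by
        refine Finset.card_le_card ?_
        intro q hq
        rw [Finset.mem_inter, Finset.mem_filter] at hq
        exact Finset.mem_inter.2 ⟨hq.2, hxU q hq.1.2⟩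
      have hKsplit : K.card ≤ (K ∩ U).card + ((univ.filter fun q => eLs q ≠ 0) ∩ K).card := by
        have hcov : K ⊆ (K ∩ U) ∪ ((univ.filter fun q => eLs q ≠ 0) ∩ K) := by
          intro q hq
          have hq' := hKU' hq
          rw [hU'def, Finset.mem_union] at hq'
          rw [Finset.mem_union, Finset.mem_inter, Finset.mem_inter]
          rcases hq' with h | h
          · exact Or.inl ⟨hq, h⟩
          · right; exact ⟨by simpa [supp] using h, hq⟩
        exact (Finset.card_le_card hcov).trans (Finset.card_union_le _ _)
      have hK2 : (K.card : ℝ) ≤ 2 * (K ∩ U).card := by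
        have : K.card ≤ 2 * (K ∩ U).card := by omega
        exact_mod_cast this
      have hDK0 : (0 : ℝ) ≤ (D ∩ CK).card := Nat.cast_nonneg _
      have hEK0 : (0 : ℝ) ≤ (E ∩ K).card := Nat.cast_nonneg _
      nlinarith [h22, hK2, hCKU, hκ0, hdM1, hDK0, hEK0]
    have hwK : ((max dA dB : ℕ) : ℝ) * hammingNorm (eK + 0)
        ≤ ((min dA dB : ℕ) : ℝ) * min (γA * Fintype.card A) (γB * Fintype.card B) := by
      rw [add_zero, heK, hammingNorm_flipVec]
      refine le_trans (mul_le_mul_of_nonneg_left ?_ hdM0) hKsmall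
      exact_mod_cast Finset.card_le_card Finset.inter_subset_right
    -- (d) `W ∩ K` is closed in `supp eK = supp E_ls ∩ K`
    have hWK : W ∩ K ⊆ supp (eK + 0) := by
      rw [add_zero, hsuppeK]
      exact Finset.inter_subset_inter hWsub subset_rfl
    have hWKX : ∀ q ∈ W ∩ K, ∀ q' ∈ supp (eK + 0), ∀ c', Hs c' q ≠ 0 → Hs c' q' ≠ 0 → q' ∈ W ∩ K := by
      intro q hq q' hq' c' h1 h2
      rw [add_zero, hsuppeK, Finset.mem_inter] at hq'
      exact Finset.mem_inter.2 ⟨hWX q (Finset.mem_inter.1 hq).1 q' hq'.1 c' h1 h2, hq'.2⟩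
    have hhaltK' : ∀ F ∈ smallSets Hg,
        ((min dA dB : ℕ) : ℝ) / 2 * F.card ≤ hammingNorm (Hs *ᵥ flipVec F) →
        ¬ (β * hammingNorm (Hs *ᵥ flipVec F) ≤ syndromeDecrease Hs (Hs *ᵥ (eK + 0) + flipVec (D ∩ CK)) F) := by
      rw [add_zero]; exact hhaltK
    have hredK' : ∀ u ∈ rowSpace Hg, hammingNorm (eK + 0) ≤ hammingNorm (eK + 0 + u) := by
      rw [add_zero]; exact hredK
    -- Lemma 25 for the check-closed part `W ∩ K` of `supp eK`
    have h25W := fgl18b_lemma25 H hreg hexp hdA hdB hδA hδB hβ0 hβ1 (eK + 0) (D ∩ CK) hhaltK' hredK' hwK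
      (W ∩ K) hWK hWKX
    rw [hcβ] at h25W
    refine h25W.trans (mul_le_mul_of_nonneg_left ?_ hc0)
    have hsub : (D ∩ CK ∩ univ.filter fun c' => ∃ q ∈ W ∩ K, Hs c' q ≠ 0)
        ⊆ D ∩ univ.filter fun c' => ∃ q ∈ W ∩ comp q₀, Hs c' q ≠ 0 := by
      intro c' hc
      rw [Finset.mem_inter, Finset.mem_inter] at hc
      exact Finset.mem_inter.2 ⟨hc.1.1, hc.2⟩
    exact_mod_cast Finset.card_le_card hsub
  -- SUM OVER COMPONENTS
  -- `W` is the disjoint union of the `W ∩ K`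
  have hWU' : W ⊆ U' := hWsub.trans hLsU'
  have hWdecomp : W = (U'.image comp).biUnion fun K => W ∩ K := by
    ext q
    rw [Finset.mem_biUnion]
    constructor
    · intro hq
      exact ⟨comp q, Finset.mem_image.2 ⟨q, hWU' hq, rfl⟩, Finset.mem_inter.2 ⟨hq, self_mem (hWU' hq)⟩⟩
    · rintro ⟨K, -, hqK⟩
      exact (Finset.mem_inter.1 hqK).1
  have hdisjW : ((U'.image comp : Finset (Finset ((A × A) ⊕ (B × B)))) : Set (Finset ((A × A) ⊕ (B × B)))).PairwiseDisjoint
      fun K => W ∩ K := by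
    intro K hK K' hK' hne
    rw [Function.onFun, Finset.disjoint_left]
    intro q hq hq'
    obtain ⟨a, -, rfl⟩ := Finset.mem_image.1 (by exact_mod_cast hK : K ∈ U'.image comp)
    obtain ⟨a', -, rfl⟩ := Finset.mem_image.1 (by exact_mod_cast hK' : K' ∈ U'.image comp)
    have h1 := comp_eq (Finset.mem_inter.1 hq).2
    have h2 := comp_eq (Finset.mem_inter.1 hq').2
    exact hne (h1.symm.trans h2)
  have hWcard : (W.card : ℝ) = ∑ K ∈ U'.image comp, ((W ∩ K).card : ℝ) := by
    have h := Finset.card_biUnion hdisjW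
    rw [← hWdecomp] at h
    exact_mod_cast h
  -- the check sets `D ∩ Γ_X(W ∩ K)` are pairwise disjoint and lie in `D ∩ Γ_X(W)`
  have hdisjC : ((U'.image comp : Finset (Finset ((A × A) ⊕ (B × B)))) : Set (Finset ((A × A) ⊕ (B × B)))).PairwiseDisjoint
      fun K => D ∩ univ.filter fun c' => ∃ q ∈ W ∩ K, Hs c' q ≠ 0 := by
    intro K hK K' hK' hne
    rw [Function.onFun, Finset.disjoint_left]
    intro c' hc hc'
    obtain ⟨a, -, rfl⟩ := Finset.mem_image.1 (by exact_mod_cast hK : K ∈ U'.image comp)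
    obtain ⟨a', -, rfl⟩ := Finset.mem_image.1 (by exact_mod_cast hK' : K' ∈ U'.image comp)
    rw [Finset.mem_inter, Finset.mem_filter] at hc hc'
    obtain ⟨q, hq, h1⟩ := hc.2.2
    obtain ⟨q', hq', h2⟩ := hc'.2.2
    have hqK : q ∈ comp a := (Finset.mem_inter.1 hq).2
    have hq'K' : q' ∈ comp a' := (Finset.mem_inter.1 hq').2
    have hq'K : q' ∈ comp a := closedX a q hqK q' (comp_subset a' hq'K') c' h1 h2
    exact hne ((comp_eq hq'K).symm.trans (comp_eq hq'K'))
  have hCsum : (∑ K ∈ U'.image comp, ((D ∩ univ.filter fun c' => ∃ q ∈ W ∩ K, Hs c' q ≠ 0).card : ℝ))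
      ≤ ((D ∩ univ.filter fun c' => ∃ q ∈ W, Hs c' q ≠ 0).card : ℝ) := by
    have h := Finset.card_biUnion hdisjC
    have hsub : ((U'.image comp).biUnion fun K => D ∩ univ.filter fun c' => ∃ q ∈ W ∩ K, Hs c' q ≠ 0)
        ⊆ D ∩ univ.filter fun c' => ∃ q ∈ W, Hs c' q ≠ 0 := by
      intro c' hc
      obtain ⟨K, -, hcK⟩ := Finset.mem_biUnion.1 hc
      rw [Finset.mem_inter, Finset.mem_filter] at hcK ⊢
      obtain ⟨q, hq, hcq⟩ := hcK.2.2
      exact ⟨hcK.1, Finset.mem_univ _, q, (Finset.mem_inter.1 hq).1, hcq⟩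
    have := Finset.card_le_card hsub
    rw [h] at this
    exact_mod_cast this
  rw [hWcard]
  calc (∑ K ∈ U'.image comp, ((W ∩ K).card : ℝ))
      ≤ ∑ K ∈ U'.image comp, c * ((D ∩ univ.filter fun c' => ∃ q ∈ W ∩ K, Hs c' q ≠ 0).card : ℝ) := by
        refine Finset.sum_le_sum fun K hK => ?_
        obtain ⟨q₀, hq₀, rfl⟩ := Finset.mem_image.1 hK
        exact hcomp q₀ hq₀
    _ = c * ∑ K ∈ U'.image comp, ((D ∩ univ.filter fun c' => ∃ q ∈ W ∩ K, Hs c' q ≠ 0).card : ℝ) := by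
        rw [Finset.mul_sum]
    _ ≤ c * ((D ∩ univ.filter fun c' => ∃ q ∈ W, Hs c' q ≠ 0).card : ℝ) :=
        mul_le_mul_of_nonneg_left hCsum hc0

end QuantumExpander

end Literature.InformationTheory.QuantumCodes
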